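import Summits.Ventures.HodgeRepro.Tier3LemmaRCorrespondence
import Summits.Ventures.HodgeRepro.Tier3WedgeRestrictScalars

/-!
# LEMMA R on the kernel with (S2), with its eigenbasis relations exported — the correspondence theorem of
`Tier3LemmaRCorrespondence` re-run with the eigen-relations of `e`, `e′` kept in the statement

Blind re-derivation cell `pub-hodge-repro`, seat `t3-p4` (Tier 3, T3.5 for T3.4 = Lemma R).  Target tree path
`lean/Summits/Ventures/HodgeRepro/Tier3LemmaRCorrespondenceEigen.lean`; imports the cell's `Tier3LemmaRCorrespondence`
and `Tier3WedgeRestrictScalars` (for `lTensor_lsmul_eigen_of_diag`).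

WHY THIS FILE (LEMMA-R-RESIDUE.md v14 §18, the composability remark; the companion of `Tier3LemmaRGeneratorEigen`).
`Tier3LemmaRCorrespondence.exists_weil_line_correspondence` — LEMMA R's generator with the rank-one structure of `W_F`
and (S2) `e₀ = Σ_m q_m • ⋀^{2k}(A′ b_m)` — exports the Galois EQUIVARIANCE of its eigenbases `e`, `e′` but not their
EIGEN-RELATIONS (its proof takes them from `Tier3PullbackDictionary.exists_equivariant_eigenbasis_pullback`, which has
them in the diagonal form `(1 ⊗ A′ b) e′(i, x) = x(b_i) • e′(i, x)`).  `exists_weil_line_correspondence_eigen` is that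
theorem with three clauses added right after the two equivariance clauses — the diagonal eigen-relations of `e` and `e′`
under `A b = (ω_j ↦ b_j • ω_j)`, `A′ b = (ω′_i ↦ b_i • ω′_i)`, and the scalar eigen-relation
`(1 ⊗ b) e′(i, x) = x(b) • e′(i, x)` (`Tier3WedgeRestrictScalars.lTensor_lsmul_eigen_of_diag`, the constant-vector
case); the proof is the correspondence theorem's, re-run with the clauses kept.  With the scalar clause,
`Tier3WeilLineRestriction.weil_line_restrictScalars` / `exists_weil_line_section` apply BY STATEMENT to the `W_F` of
this theorem (as `Tier3LemmaRGeneratorEigen.exists_weil_line_generator_restrictScalars` does for the generator's):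
LEMMA R's Weil line, with (S2), IS `∧^{2k}_K V_B` embedded by Deligne's direct summand (D1 Lemma 4.3(b)).

Nothing mathematical moves (LEMMA-R-RESIDUE v14: residue 0 unchanged); this is the one-clause re-export §18 labelled
for a successor, on the second of the two statements it names.

HONESTY.  Linear algebra on the cell's own modules; no definition is introduced; nothing geometric is built.
HC_CM is NOT proved by anyone in this repository.
-/

set_option autoImplicit false

open TensorProduct Finset

namespace HodgeRepro.Tier3

open HodgeRepro.RouteC HodgeRepro.CMHodgeOn

section CorrespondenceEigen

variable {F₀ K : Type*} [Field F₀] [Field K] [Algebra F₀ K]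
variable {Vr VB : Type*} [AddCommGroup Vr] [Module K Vr] [Module F₀ Vr] [IsScalarTower F₀ K Vr]
  [AddCommGroup VB] [Module K VB] [Module F₀ VB] [IsScalarTower F₀ K VB]
variable {J ι : Type*} [Fintype J] [DecidableEq J] [Fintype ι] [DecidableEq ι] [DecidableEq (K ≃ₐ[F₀] K)]
variable [FiniteDimensional F₀ K] [IsGalois F₀ K] [Algebra K ℂ]

/-- **LEMMA R on the kernel, with (S2) and the eigen-relations exported**
(`Tier3LemmaRCorrespondence.exists_weil_line_correspondence` with three clauses added after the equivariance clauses: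
`(1 ⊗ A b) e(j, x) = x(b_j) • e(j, x)`, `(1 ⊗ A′ b) e′(i, x) = x(b_i) • e′(i, x)` for the diagonal operators
`A b = (ω_j ↦ b_j • ω_j)`, `A′ b = (ω′_i ↦ b_i • ω′_i)`, and `(1 ⊗ b) e′(i, x) = x(b) • e′(i, x)` for the scalars
`b ∈ K`).  Everything else — the base changes, the wedge bases, the Weil line `W_F` with its rational projector `e₀`,
`dim_{F₀} W_F = [K : F₀]`, `W_F` a rank-one `K`-module under `act(a)`, (S2) `e₀ = Σ_m q_m • ⋀^{2k}(A′ b_m)`, and for every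
`W ⊇` the reduced-set wedges (Pohlmann) a non-zero `η ∈ W` generating `W_F` through `e₀ ∘ ⋀^{2k} M` and the
correspondences `⋀^{2k}(A′ ((a at i₀, 1 elsewhere) · b_m)) ∘ ⋀^{2k} M` — is stated verbatim. -/
theorem exists_weil_line_correspondence_eigen {k : ℕ} [Nonempty ι]
    (cls : ι → J) (tw : ι → K ≃ₐ[F₀] K) (hinj : Function.Injective fun i => (cls i, tw i))
    (hcard : Fintype.card ι = 2 * k)
    (ω : Module.Basis J K Vr) (ω' : Module.Basis ι K VB) (M : Vr →ₗ[F₀] VB)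
    (hM : ∀ (c : K) (j : J), M (c • ω j) = ∑ i ∈ univ.filter (fun i => cls i = j), ((tw i)⁻¹ c) • ω' i)
    [LinearOrder (J × (K ≃ₐ[F₀] K))] [LinearOrder (ι × (K ≃ₐ[F₀] K))]
    [MulAction (K ≃ₐ[F₀] K) (J × (K ≃ₐ[F₀] K))]
    (hact : ∀ (σ x : K ≃ₐ[F₀] K) (j : J), σ • (j, x) = (j, σ * x))
    [MulAction (K ≃ₐ[F₀] K) (ι × (K ≃ₐ[F₀] K))]
    (hact' : ∀ (σ x : K ≃ₐ[F₀] K) (i : ι), σ • (i, x) = (i, σ * x))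
    (i₀ : ι) :
    ∃ (e : Module.Basis (J × (K ≃ₐ[F₀] K)) K (K ⊗[F₀] Vr))
      (E : Module.Basis (Set.powersetCard (J × (K ≃ₐ[F₀] K)) (2 * k)) K (K ⊗[F₀] ⋀[F₀]^(2 * k) Vr))
      (Φ : K ⊗[F₀] ⋀[F₀]^(2 * k) Vr ≃ₗ[K] ⋀[K]^(2 * k) (K ⊗[F₀] Vr))
      (e' : Module.Basis (ι × (K ≃ₐ[F₀] K)) K (K ⊗[F₀] VB))
      (E' : Module.Basis (Set.powersetCard (ι × (K ≃ₐ[F₀] K)) (2 * k)) K (K ⊗[F₀] ⋀[F₀]^(2 * k) VB))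
      (Φ' : K ⊗[F₀] ⋀[F₀]^(2 * k) VB ≃ₗ[K] ⋀[K]^(2 * k) (K ⊗[F₀] VB))
      (WF : Submodule F₀ (⋀[F₀]^(2 * k) VB))
      (e₀ : ⋀[F₀]^(2 * k) VB →ₗ[F₀] ⋀[F₀]^(2 * k) VB),
      (∀ (σ x : K ≃ₐ[F₀] K) (j : J), LinearMap.rTensor Vr σ.toLinearMap (e (j, x)) = e (j, σ * x)) ∧
      (∀ (σ x : K ≃ₐ[F₀] K) (i : ι), LinearMap.rTensor VB σ.toLinearMap (e' (i, x)) = e' (i, σ * x)) ∧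
      -- the eigen-relations of `e`, `e′` under the diagonal actions `A b`, `A′ b` and under the scalars of `K`
      (∀ (x : K ≃ₐ[F₀] K) (j : J) (b : J → K),
        LinearMap.lTensor K ((ω.constr K fun j => b j • ω j).restrictScalars F₀) (e (j, x)) =
          x (b j) • e (j, x)) ∧
      (∀ (x : K ≃ₐ[F₀] K) (i : ι) (b : ι → K),
        LinearMap.lTensor K ((ω'.constr K fun i => b i • ω' i).restrictScalars F₀) (e' (i, x)) =
          x (b i) • e' (i, x)) ∧
      (∀ (x : K ≃ₐ[F₀] K) (i : ι) (b : K),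
        LinearMap.lTensor K ((LinearMap.lsmul K VB b).restrictScalars F₀) (e' (i, x)) = x b • e' (i, x)) ∧
      (∀ (x : K ≃ₐ[F₀] K) (j : J),
        LinearMap.lTensor K M (e (j, x)) = ∑ i ∈ univ.filter (fun i => cls i = j), e' (i, x * tw i)) ∧
      (∀ (c : K) (v : Fin (2 * k) → Vr),
        Φ (c ⊗ₜ[F₀] exteriorPower.ιMulti F₀ (2 * k) v) =
          c • exteriorPower.ιMulti K (2 * k) (fun i => (1 : K) ⊗ₜ[F₀] v i)) ∧
      (∀ (c : K) (w : Fin (2 * k) → VB),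
        Φ' (c ⊗ₜ[F₀] exteriorPower.ιMulti F₀ (2 * k) w) =
          c • exteriorPower.ιMulti K (2 * k) (fun i => (1 : K) ⊗ₜ[F₀] w i)) ∧
      (∀ s, Φ (E s) = exteriorPower.ιMulti_family K (2 * k) e s) ∧
      (∀ s, Φ' (E' s) = exteriorPower.ιMulti_family K (2 * k) e' s) ∧
      -- the Weil line and its rational projector
      WF.baseChange K =
        Submodule.span K (E' '' {L | ∃ σ : K ≃ₐ[F₀] K, (L : Finset (ι × (K ≃ₐ[F₀] K))) = lineSet σ}) ∧
      (∀ v, e₀ v ∈ WF) ∧ (∀ w ∈ WF, e₀ w = w) ∧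
      (∀ (v : ⋀[F₀]^(2 * k) VB) (L : Set.powersetCard (ι × (K ≃ₐ[F₀] K)) (2 * k)),
        E'.repr ((1 : K) ⊗ₜ[F₀] e₀ v) L =
          if ∃ σ : K ≃ₐ[F₀] K, (L : Finset (ι × (K ≃ₐ[F₀] K))) = lineSet σ
          then E'.repr ((1 : K) ⊗ₜ[F₀] v) L else 0) ∧
      Module.finrank F₀ WF = Module.finrank F₀ K ∧
      -- the Weil line is a rank-one `K`-module under the first corner's action: `act(a)`-stable, every non-zero
      -- vector generates (`Tier3LemmaR.WeilRankOne` in abstract form)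
      (∀ (a : K) (w : ⋀[F₀]^(2 * k) VB), w ∈ WF → exteriorPower.map (2 * k)
        ((ω'.constr K fun i => Function.update (fun _ => (1 : K)) i₀ a i • ω' i).restrictScalars F₀) w ∈ WF) ∧
      (∀ w ∈ WF, w ≠ 0 → ∀ x ∈ WF, ∃ a : K, x = exteriorPower.map (2 * k)
        ((ω'.constr K fun i => Function.update (fun _ => (1 : K)) i₀ a i • ω' i).restrictScalars F₀) w) ∧
      -- (S2): the rational projector is an `F₀`-combination of the diagonal operators `⋀^{2k}(A′ b)`
      (∃ (N : ℕ) (q : Fin N → F₀) (b : Fin N → (ι → K)),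
        e₀ = ∑ m, q m • exteriorPower.map (2 * k) ((ω'.constr K fun i => b m i • ω' i).restrictScalars F₀) ∧
        -- LEMMA R: the generator `e · m^* η` of the Weil line, and `W_F` in the `ℚ`-span of the pull-backs of `η`
        ∀ (W : Submodule F₀ (⋀[F₀]^(2 * k) Vr)),
          (∀ s : Set.powersetCard (J × (K ≃ₐ[F₀] K)) (2 * k),
            (∃ σ, (s : Finset (J × (K ≃ₐ[F₀] K))) = reducedSet cls tw σ) → E s ∈ W.baseChange K) →
          ∃ η ∈ W, η ≠ 0 ∧
            e₀ (exteriorPower.map (2 * k) M η) ∈ WF ∧ e₀ (exteriorPower.map (2 * k) M η) ≠ 0 ∧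
            ∀ x ∈ WF, ∃ a : K,
              x = exteriorPower.map (2 * k)
                ((ω'.constr K fun i => Function.update (fun _ => (1 : K)) i₀ a i • ω' i).restrictScalars F₀)
                (e₀ (exteriorPower.map (2 * k) M η)) ∧
              x = ∑ m, q m • exteriorPower.map (2 * k)
                ((ω'.constr K fun i => (Function.update (fun _ => (1 : K)) i₀ a * b m) i • ω' i).restrictScalars F₀)
                (exteriorPower.map (2 * k) M η)) := by
  classical
  -- the eigenbasis pair with the pull-back relation (Tier3PullbackDictionary)
  obtain ⟨e, e', he1, he2, he1', he2', hMe⟩ := exists_equivariant_eigenbasis_pullback ω ω'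
    (fun b => ω.constr K fun j => b j • ω j) (fun b j => by rw [Module.Basis.constr_basis])
    (fun b => ω'.constr K fun i => b i • ω' i) (fun b i => by rw [Module.Basis.constr_basis])
    cls tw M hM
  have hequiv' : ∀ (σ : K ≃ₐ[F₀] K) (p : ι × (K ≃ₐ[F₀] K)),
      LinearMap.rTensor VB σ.toLinearMap (e' p) = e' (σ • p) := by
    rintro σ ⟨i, x⟩
    rw [hact', he1']
  obtain ⟨Φ, hΦ⟩ := exists_wedgeBaseChange (F₀ := F₀) (K := K) (V := Vr) (2 * k)
  obtain ⟨Φ', hΦ'⟩ := exists_wedgeBaseChange (F₀ := F₀) (K := K) (V := VB) (2 * k)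
  obtain ⟨E, hEdef⟩ : ∃ E : Module.Basis (Set.powersetCard (J × (K ≃ₐ[F₀] K)) (2 * k)) K
      (K ⊗[F₀] ⋀[F₀]^(2 * k) Vr), E = (e.exteriorPower (2 * k)).map Φ.symm := ⟨_, rfl⟩
  obtain ⟨E', hE'def⟩ : ∃ E' : Module.Basis (Set.powersetCard (ι × (K ≃ₐ[F₀] K)) (2 * k)) K
      (K ⊗[F₀] ⋀[F₀]^(2 * k) VB), E' = (e'.exteriorPower (2 * k)).map Φ'.symm := ⟨_, rfl⟩
  have hE : ∀ s, Φ (E s) = exteriorPower.ιMulti_family K (2 * k) e s := by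
    intro s
    rw [hEdef, Module.Basis.map_apply, LinearEquiv.apply_symm_apply, exteriorPower.basis_apply]
  have hE' : ∀ s, Φ' (E' s) = exteriorPower.ιMulti_family K (2 * k) e' s := by
    intro s
    rw [hE'def, Module.Basis.map_apply, LinearEquiv.apply_symm_apply, exteriorPower.basis_apply]
  -- the `σ`-lines as `2k`-subsets, and their finite set `P`
  have hcardL : ∀ σ : K ≃ₐ[F₀] K, (lineSet (ι := ι) σ).card = 2 * k := by
    intro σ
    rw [card_lineSet, hcard]
  obtain ⟨U, hU⟩ : ∃ U : (K ≃ₐ[F₀] K) → Set.powersetCard (ι × (K ≃ₐ[F₀] K)) (2 * k),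
      ∀ σ, (U σ : Finset (ι × (K ≃ₐ[F₀] K))) = lineSet σ :=
    ⟨fun σ => ⟨lineSet σ, Set.powersetCard.mem_iff.mpr (hcardL σ)⟩, fun σ => rfl⟩
  have hmemU : ∀ (σ : K ≃ₐ[F₀] K) (p : ι × (K ≃ₐ[F₀] K)), p ∈ U σ ↔ p.2 = σ := by
    intro σ p
    rw [← Set.powersetCard.mem_coe_iff, hU σ, mem_lineSet]
  have hUinj : Function.Injective U := by
    intro σ τ h
    obtain ⟨i⟩ := ‹Nonempty ι›
    have h1 : (i, σ) ∈ U τ := by rw [← h, hmemU]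
    rw [hmemU] at h1
    exact h1
  obtain ⟨P, hPdef⟩ : ∃ P : Finset (Set.powersetCard (ι × (K ≃ₐ[F₀] K)) (2 * k)), P = Finset.univ.image U :=
    ⟨_, rfl⟩
  have hmemP : ∀ L : Set.powersetCard (ι × (K ≃ₐ[F₀] K)) (2 * k),
      L ∈ P ↔ ∃ σ : K ≃ₐ[F₀] K, (L : Finset (ι × (K ≃ₐ[F₀] K))) = lineSet σ := by
    intro L
    rw [hPdef, Finset.mem_image]
    constructor
    · rintro ⟨σ, -, rfl⟩
      exact ⟨σ, hU σ⟩
    · rintro ⟨σ, hσ⟩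
      exact ⟨σ, Finset.mem_univ _, Subtype.ext ((hU σ).trans hσ.symm)⟩
  have hP : ∀ (τ : K ≃ₐ[F₀] K), ∀ L ∈ P, ∃ L' ∈ P, ∀ p, p ∈ L' ↔ ∃ q ∈ L, τ • q = p := by
    intro τ L hL
    rw [hPdef] at hL
    obtain ⟨σ, -, rfl⟩ := Finset.mem_image.mp hL
    refine ⟨U (τ * σ), by rw [hPdef]; exact Finset.mem_image_of_mem U (Finset.mem_univ _), fun p => ?_⟩
    rw [hmemU]
    constructor
    · intro hp
      refine ⟨(p.1, σ), (hmemU σ _).mpr rfl, ?_⟩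
      rw [hact', ← hp]
    · rintro ⟨q, hq, rfl⟩
      rw [hmemU] at hq
      obtain ⟨q1, q2⟩ := q
      rw [hact']
      simp only at hq
      rw [hq]
  -- the Weil line and its rational projector (Tier3WeilProjector via Tier3LemmaRWeilLine §1)
  obtain ⟨WF, e₀, hWF, he₀mem, he₀id, he₀tmul⟩ :=
    exists_rational_projector_wedge (2 * k) e' hequiv' Φ' hΦ' P hP
  rw [← hE'def] at hWF he₀tmul
  have hWF' : WF.baseChange K =
      Submodule.span K (E' '' {L | ∃ σ : K ≃ₐ[F₀] K, (L : Finset (ι × (K ≃ₐ[F₀] K))) = lineSet σ}) := by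
    rw [hWF]
    congr 2
    ext L
    exact hmemP L
  -- the coordinate description of the projector
  have hrepr : ∀ (v : ⋀[F₀]^(2 * k) VB) (L : Set.powersetCard (ι × (K ≃ₐ[F₀] K)) (2 * k)),
      E'.repr ((1 : K) ⊗ₜ[F₀] e₀ v) L =
        if ∃ σ : K ≃ₐ[F₀] K, (L : Finset (ι × (K ≃ₐ[F₀] K))) = lineSet σ
        then E'.repr ((1 : K) ⊗ₜ[F₀] v) L else 0 := by
    intro v L
    have hsum : E'.repr (∑ s ∈ P, E'.repr ((1 : K) ⊗ₜ[F₀] v) s • E' s) L =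
        if L ∈ P then E'.repr ((1 : K) ⊗ₜ[F₀] v) L else 0 := by
      rw [map_sum, Finsupp.finsetSum_apply]
      simp only [map_smul, Module.Basis.repr_self, Finsupp.smul_single, smul_eq_mul, mul_one,
        Finsupp.single_apply]
      rw [Finset.sum_ite_eq' P L]
    rw [he₀tmul v, hsum]
    by_cases hLP : L ∈ P
    · rw [if_pos hLP, if_pos ((hmemP L).mp hLP)]
    · rw [if_neg hLP, if_neg (fun h => hLP ((hmemP L).mpr h))]
  -- the dimension count (Tier3WeilProjector)
  have hdim : Module.finrank F₀ WF = Module.finrank F₀ K :=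
    finrank_eq_finrank_of_baseChange_eq_span_image E' U hUinj WF (by rw [hWF, hPdef])
  -- the first corner's multiplication on the σ-line wedges, on any rational vector of the Weil line
  have hli : LinearIndependent K (E' ∘ U) := E'.linearIndependent.comp U hUinj
  have hEact : ∀ (a : K) (σ : K ≃ₐ[F₀] K),
      LinearMap.baseChange K (exteriorPower.map (2 * k)
        ((ω'.constr K fun i => Function.update (fun _ => (1 : K)) i₀ a i • ω' i).restrictScalars F₀)) (E' (U σ)) =
        σ a • E' (U σ) := by
    intro a σ
    apply Φ'.injective
    rw [wedgeBaseChange_naturality (2 * k) Φ' hΦ' Φ' hΦ', hE', LinearEquiv.map_smul, hE']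
    exact map_baseChange_update_ιMulti_family_lineSet (fun b => ω'.constr K fun i => b i • ω' i) e' he2' hcard
      i₀ a σ (U σ) (hU σ)
  have hWtmul : ∀ w ∈ WF, (1 : K) ⊗ₜ[F₀] w = ∑ σ, E'.repr ((1 : K) ⊗ₜ[F₀] w) (U σ) • E' (U σ) := by
    intro w hw
    conv_lhs => rw [← he₀id w hw]
    rw [he₀tmul, hPdef, Finset.sum_image (fun σ _ τ _ h => hUinj h)]
  have hact_tmulW : ∀ (a : K) (w : ⋀[F₀]^(2 * k) VB), w ∈ WF → (1 : K) ⊗ₜ[F₀] exteriorPower.map (2 * k)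
      ((ω'.constr K fun i => Function.update (fun _ => (1 : K)) i₀ a i • ω' i).restrictScalars F₀) w =
      ∑ σ, (σ a * E'.repr ((1 : K) ⊗ₜ[F₀] w) (U σ)) • (E' ∘ U) σ := by
    intro a w hw
    obtain ⟨c, hc⟩ : ∃ c : (K ≃ₐ[F₀] K) → K, c = fun σ => E'.repr ((1 : K) ⊗ₜ[F₀] w) (U σ) := ⟨_, rfl⟩
    have h1 : (1 : K) ⊗ₜ[F₀] w = ∑ σ, c σ • E' (U σ) := by rw [hWtmul w hw, hc]
    have key : (1 : K) ⊗ₜ[F₀] exteriorPower.map (2 * k)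
        ((ω'.constr K fun i => Function.update (fun _ => (1 : K)) i₀ a i • ω' i).restrictScalars F₀) w =
        ∑ σ, (σ a * c σ) • (E' ∘ U) σ := by
      rw [← LinearMap.baseChange_tmul, h1, map_sum]
      refine Finset.sum_congr rfl fun σ _ => ?_
      rw [map_smul, hEact, smul_smul, mul_comm (c σ) (σ a)]
      rfl
    rw [key, hc]
  have hact_memW : ∀ (a : K) (w : ⋀[F₀]^(2 * k) VB), w ∈ WF → exteriorPower.map (2 * k)
      ((ω'.constr K fun i => Function.update (fun _ => (1 : K)) i₀ a i • ω' i).restrictScalars F₀) w ∈ WF := by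
    intro a w hw
    rw [← tmul_one_mem_baseChange_iff (K := K), hWF, hact_tmulW a w hw]
    refine Submodule.sum_mem _ fun σ _ => Submodule.smul_mem _ _ (Submodule.subset_span ?_)
    exact ⟨U σ, by rw [hPdef]; exact Finset.mem_image_of_mem U (Finset.mem_univ _), rfl⟩
  have hrank : ∀ w ∈ WF, w ≠ 0 → ∀ x ∈ WF, ∃ a : K, x = exteriorPower.map (2 * k)
      ((ω'.constr K fun i => Function.update (fun _ => (1 : K)) i₀ a i • ω' i).restrictScalars F₀) w := by
    intro w hw hw0
    have hc : ∃ σ₁, E'.repr ((1 : K) ⊗ₜ[F₀] w) (U σ₁) ≠ 0 := by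
      by_contra hall
      simp only [not_exists, not_not] at hall
      apply hw0
      apply tmul_one_injective (F₀ := F₀) (K := K)
      rw [hWtmul w hw, TensorProduct.tmul_zero]
      exact Finset.sum_eq_zero fun σ _ => by rw [hall σ, zero_smul]
    exact forall_mem_exists_eq_of_tmul_eq_sum' WF hdim (E' ∘ U) hli _ hc _ (fun a => hact_tmulW a w hw)
      (fun a => hact_memW a w hw)
  -- (S2): the projector as an `F₀`-combination of the diagonal operators (Tier3ProjectorCorrespondence)
  have he₀tmul' : ∀ v, (1 : K) ⊗ₜ[F₀] e₀ v = ∑ L ∈ Finset.univ.image U,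
      ((e'.exteriorPower (2 * k)).map Φ'.symm).repr ((1 : K) ⊗ₜ[F₀] v) L •
        ((e'.exteriorPower (2 * k)).map Φ'.symm) L := by
    intro v
    rw [he₀tmul v, hPdef, hE'def]
  obtain ⟨N, q, b, hq⟩ := exists_eq_sum_smul_map_diag (fun b => ω'.constr K fun i => b i • ω' i) e' he2' hcard
    Φ' hΦ' U hU hUinj e₀ he₀tmul'
  -- the scalar eigen-relation of `e′` is the constant-vector case of the diagonal one (Tier3WedgeRestrictScalars)
  have hscal : ∀ (x : K ≃ₐ[F₀] K) (i : ι) (b : K),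
      LinearMap.lTensor K ((LinearMap.lsmul K VB b).restrictScalars F₀) (e' (i, x)) = x b • e' (i, x) :=
    fun x i b => lTensor_lsmul_eigen_of_diag ω' (fun b => ω'.constr K fun i => b i • ω' i)
      (fun b i => by rw [Module.Basis.constr_basis]) e' he2' x i b
  refine ⟨e, E, Φ, e', E', Φ', WF, e₀, he1, he1', he2, he2', hscal, hMe, hΦ, hΦ', hE, hE', hWF', he₀mem, he₀id,
    hrepr, hdim, hact_memW, hrank, N, q, b, hq, ?_⟩
  intro W hPW
  -- LEMMA R's non-vanishing for these bases (Tier3LemmaRWeilLine §3)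
  obtain ⟨η, hηW, hη0, hcoef⟩ := exists_rational_class_repr_lineSet_ne_zero_of_data cls tw hinj hcard ω ω' M
    hact e e' he1 he2 he2' hMe Φ hΦ Φ' hΦ' W (by rw [← hEdef]; exact hPW)
  rw [← hE'def] at hcoef
  obtain ⟨w₀, hw₀def⟩ : ∃ w₀ : ⋀[F₀]^(2 * k) VB, w₀ = e₀ (exteriorPower.map (2 * k) M η) := ⟨_, rfl⟩
  have hw₀mem : w₀ ∈ WF := by rw [hw₀def]; exact he₀mem _
  -- the coefficients of `w₀` on the `σ`-lines are those of `⋀^{2k} M η` (the projector keeps them), all non-zero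
  have hc₀ : ∀ σ, E'.repr ((1 : K) ⊗ₜ[F₀] w₀) (U σ) ≠ 0 := by
    intro σ
    rw [hw₀def, hrepr, if_pos ⟨σ, hU σ⟩]
    exact hcoef σ (U σ) (hU σ)
  have hw₀ne : w₀ ≠ 0 :=
    ne_zero_of_tmul_eq_sum (E' ∘ U) hli (fun σ => E'.repr ((1 : K) ⊗ₜ[F₀] w₀) (U σ)) (hc₀ 1) w₀ (hWtmul w₀ hw₀mem)
  have hgen := hrank w₀ hw₀mem hw₀ne
  rw [hw₀def] at hw₀ne hgen
  refine ⟨η, hηW, hη0, he₀mem _, hw₀ne, fun x hx => ?_⟩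
  obtain ⟨a, ha⟩ := hgen x hx
  refine ⟨a, ha, ?_⟩
  have hcomp := map_comp_eq_sum_smul_map_diag ω' (2 * k) i₀ a e₀ q b hq
  have := LinearMap.congr_fun hcomp (exteriorPower.map (2 * k) M η)
  rw [LinearMap.comp_apply, LinearMap.sum_apply] at this
  rw [ha, this]
  refine Finset.sum_congr rfl fun m _ => ?_
  rw [LinearMap.smul_apply]

end CorrespondenceEigen

end HodgeRepro.Tier3
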